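import Summits.FinalStateConjecture.FinalStateConjecture.Theorems.PhotonSphereChannelsTameCensorshipExactKerrBookkeepingOfFacts
import Literature.Geometry.Lorentzian.KerrRegionIIDiameter
import HarnessLib

/-!
# Crux `TameCensorship` (stmt-FinalStateConjecture-10047), line `crush-the-swallowed-interior`:
# clauses (B1)–(B3) of stub B from leaf-maximality ALONE — the region-II diameter fact discharged

`exactKerrBookkeeping_B123_of_facts` (file `…ExactKerrBookkeepingOfFacts`) derived clauses
(B1) ∧ (B2) ∧ (B3) of the registered stub `stub_exactKerrBookkeeping` from two displayed named
facts, F_B1 (the leaf datum `D.comap φ` has a maximal vacuum development carried isometrically and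
time-orientably by `Kerr.spacetime M a r₋`) and F_B3 (finite timelike diameter of Kerr's region
II). F_B3 is now a THEOREM of the tree — `Literature.Geometry.Lorentzian.Kerr.lorentzDist_le_of_radius_lt_rPlus`
(`KerrRegionIIDiameter`: `d(x, y) ≤ 4√2 √(r₊² + a²)` for `r(x) < r₊`, from the timelike gradient
of `r` on region II, the reverse Cauchy–Schwarz speed bound and an explicit integrable clock) — so
this file records the sharper reduction

* `exactKerrBookkeeping_B123_of_leafMaximal` — (B1) ∧ (B2) ∧ (B3) of the stub, verbatim, from
  F_B1 alone.

What remains of stub B after this: F_B1 (Choquet-Bruhat–Geroch maximality of the Kerr leaf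
development, a universal-receiver property not certifiable in-tree) and clause (B4) (Kerr ray
optics above the leaf + two-sided bounded geometry of the exterior, through
`SubdataDevelopmentsEmbed`).

References: O'Neill 1995, §2.4–2.5; Choquet-Bruhat–Geroch 1969, Thm. 3; O'Neill 1983, Ch. 14,
Def. 14.15.
-/

noncomputable section

-- The tree namespace `Summit.FinalStateConjecture.FinalStateConjecture.…` (summit = sub-problem)
-- repeats a component by design (D-0022), which the `dupNamespace` linter would flag on every decl.
set_option linter.dupNamespace false

open scoped Manifold ContDiff Topology
open Set Filter Function TopologicalSpace Topology
open Literature.Geometry.Lorentzian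

namespace Summit.FinalStateConjecture.FinalStateConjecture.Theorems.PhotonSphereChannels.TameCensorshipCrush

open scoped ENNReal NNReal in
/-- **Clauses (B1)–(B3) of stub B from leaf-maximality alone**: as
`exactKerrBookkeeping_B123_of_facts`, with the region-II diameter hypothesis discharged by
`Kerr.lorentzDist_le_of_radius_lt_rPlus` (constant `√(r₊² + a²) · regionIIClockBound r₋ r₊`).
[cite: ONeill1995, §2.5; ChoquetBruhatGeroch1969CMP, Thm. 3] -/
theorem exactKerrBookkeeping_B123_of_leafMaximal :
    ∀ [Kerr.Facts], ∀ (X : Type) [TopologicalSpace X] [ChartedSpace E3 X] [IsManifold (𝓡 3) ∞ X]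
      [T2Space X] [SecondCountableTopology X] [ConnectedSpace X], ∀ D ∈ admissibleVacuumData X, ∀
      (M a r₁ : ℝ) (hM : 0 ≤ M) (T : ℝ → ℝ) (φ : Kerr.slice a r₁ → X) (ψ : Kerr.slice a r₁ →
      Kerr.region a r₁) (ν : NormalField 𝓘(ℝ, E4) ψ), (|a| < M ∧ Kerr.rMinus M a < r₁ ∧ r₁ <
      Kerr.rPlus M a ∧ T = (fun r : ℝ => Real.smoothTransition (r / (4 * M) - 1) * (((M) /
      Real.sqrt ((M) ^ 2 - (a) ^ 2)) * (Kerr.rPlus M a * Real.log (r - Kerr.rPlus M a) -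
      Kerr.rMinus M a * Real.log (r - Kerr.rMinus M a)) - ((M) / Real.sqrt ((M) ^ 2 - (a) ^ 2)) *
      (Kerr.rPlus M a * Real.log ((4 * M) - Kerr.rPlus M a) - Kerr.rMinus M a * Real.log ((4 * M)
      - Kerr.rMinus M a)))) ∧ IsCompact (Set.range φ)ᶜ ∧ Topology.IsOpenEmbedding φ ∧ ContMDiff
      𝓘(ℝ, E3) (𝓡 3) ((⊤ : ℕ∞) : WithTop ℕ∞) φ ∧ (∀ y : Kerr.slice a r₁, (ψ y : E4) =
      E4.ofTimeSpace (T (Kerr.radius a (E4.ofTimeSpace 0 (y : E3)))) (y : E3)) ∧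
      (Kerr.smoothMetric M a r₁).IsSpacelikeImmersion 𝓘(ℝ, E3) ψ ∧ (Kerr.smoothMetric M a
      r₁).IsFutureUnitNormal 𝓘(ℝ, E3) ((Kerr.timeOrientation M a r₁ hM).ofLE le_top) ψ ν ∧ (∀ y :
      Kerr.slice a r₁, (pullbackBilin φ D.h.inner y : TangentSpace 𝓘(ℝ, E3) y →L[ℝ] TangentSpace
      𝓘(ℝ, E3) y →L[ℝ] ℝ) = pullbackBilin ψ (Kerr.smoothMetric M a r₁).val y) ∧ (∀
      [(Kerr.smoothMetric M a r₁).HasLeviCivita] (y : Kerr.slice a r₁), (pullbackBilin φ D.k y :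
      TangentSpace 𝓘(ℝ, E3) y →L[ℝ] TangentSpace 𝓘(ℝ, E3) y →L[ℝ] ℝ).toLinearMap₁₂ =
      (Kerr.smoothMetric M a r₁).secondFundamentalForm 𝓘(ℝ, E3) ψ ν y)) → ∀ 𝒟 :
      VacuumCauchyDevelopment D, 𝒟.IsMaximal → ∀ [𝒟.metric.HasLeviCivita], (∀ [ConnectedSpace
      (Kerr.slice a r₁)] (hφ1 : ContMDiff (𝓡 3) (𝓡 3) (((⊤ : ℕ∞) : WithTop ℕ∞) + 1) φ) (hφ' : ∀ u,
      Function.Injective (mfderiv (𝓡 3) (𝓡 3) φ u)), ∃ 𝒦 : VacuumCauchyDevelopment (D.comap φ hφ1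
      hφ'), 𝒦.IsMaximal ∧ ∃ ε : 𝒦.carrier → (Kerr.spacetime M a (Kerr.rMinus M a) hM).carrier,
      ContMDiff (𝓡 4) (𝓡 4) ((⊤ : ℕ∞) : WithTop ℕ∞) ε ∧ (∀ p, pullbackBilin (I := 𝓡 4) (I' := 𝓡 4)
      ε (Kerr.spacetime M a (Kerr.rMinus M a) hM).metric.val p = 𝒦.metric.val p) ∧
      𝒦.timeOrientation.PreservesTimeOrientation ε (Kerr.spacetime M a (Kerr.rMinus M a)
      hM).timeOrientation) → ∃ (E' : Set 𝒟.carrier) (χ : 𝒟.carrier → (Kerr.spacetime M a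
      (Kerr.rMinus M a) hM).carrier), (𝒟.metric.causalFuture 𝒟.timeOrientation (Set.range 𝒟.embed)
      \ 𝒟.metric.causalFuture 𝒟.timeOrientation (𝒟.embed '' (Set.range φ)ᶜ)) ⊆ E' ∧ (IsOpen E' ∧
      ContMDiffOn (𝓡 4) (𝓡 4) ∞ χ E' ∧ ∀ p ∈ E', pullbackBilin χ (Kerr.spacetime M a (Kerr.rMinus
      M a) hM).metric.val p = 𝒟.metric.val p) ∧ (∀ m ∈ 𝒟.metric.causalFuture 𝒟.timeOrientation
      (𝒟.embed '' (Set.range φ)ᶜ), 𝒟.metric.causalFuture 𝒟.timeOrientation {m} ⊆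
      𝒟.metric.causalFuture 𝒟.timeOrientation (𝒟.embed '' (Set.range φ)ᶜ)) ∧ (∃ C : ℝ≥0, ∀ p ∈
      (𝒟.metric.causalFuture 𝒟.timeOrientation (Set.range 𝒟.embed) \ 𝒟.metric.causalFuture
      𝒟.timeOrientation (𝒟.embed '' (Set.range φ)ᶜ)), Kerr.radius a (χ p).1 < Kerr.rPlus M a → ∀ q
      ∈ (𝒟.metric.causalFuture 𝒟.timeOrientation (Set.range 𝒟.embed) \ 𝒟.metric.causalFuture
      𝒟.timeOrientation (𝒟.embed '' (Set.range φ)ᶜ)), 𝒟.toSpacetime.lorentzDist p q ≤ (C : ℝ≥0∞))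
 := by
  intro hKF X _ _ _ _ _ _ D hD M a r₁ hM T φ ψ ν hsh 𝒟 h𝒟 hLC hF1
  have ha : |a| < M := hsh.1
  refine exactKerrBookkeeping_B123_of_facts X D hD M a r₁ hM T φ ψ ν hsh 𝒟 h𝒟 hF1 ?_
  refine ⟨(Real.sqrt (Kerr.rPlus M a ^ 2 + a ^ 2) *
    Kerr.regionIIClockBound (Kerr.rMinus M a) (Kerr.rPlus M a)).toNNReal, fun x y hx ↦ ?_⟩
  exact Kerr.lorentzDist_le_of_radius_lt_rPlus ha hM x y hx

end Summit.FinalStateConjecture.FinalStateConjecture.Theorems.PhotonSphereChannels.TameCensorshipCrush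

end
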